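import Mathlib.Algebra.BigOperators.Associated
import Mathlib.Data.Nat.PrimeFin
import Mathlib.RingTheory.Int.Basic
import Mathlib.Tactic.LinearCombination

/-!
# Route LinearSystemTorelli — crux `LocalTubeSpan` (stmt-HodgeConjecture-2490): coprime shift

Helper file (`--supports stmt-HodgeConjecture-2490`, line `Sketch` of the crux chain, cycle 7,
lead c6: "coprime shift — arithmetic input of the unimodular transitivity of the level-2
elementary moves", stub `stub_coprimeShift`).

Cycle 7 derives Janssen's Theorem 2.9 from Theorem 2.5 through a transitivity theorem for the
level-2 elementary moves on unimodular lattice vectors.  Its pure arithmetic input: a unimodular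
vector has coordinates `A` (odd) and `β`, and an orthogonal pairing `j`, with a Bézout relation
`U·A + 2W·β + j = 1`; the move `E_{x, s w₁}²` shifts `A ↦ A + 2sj`, and one needs a shift making
`A + 2sj` coprime to `β`.

* `localTubeSpan_coprimeShift` — if `A` is odd, `U * A + 2 * W * β + j = 1`, `β ≠ 0` and `j ≠ 0`,
  then `IsCoprime (A + s * (2 * j)) β` for some `s : ℤ`.

Proof (the row-primitivity argument of `exists_isCoprime_add_mul` in
`Literature.NumberTheory.EllipticCurves.HeckeOperatorsDoubleCoset` for the primitive integer
matrix `(A β; 2j 0)` of determinant `-2jβ ≠ 0`, made self-contained so that the line's import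
closure stays inside Mathlib + Hodge theory): no prime divides `A`, `β` and `2j` (it would divide
`2·(U·A + 2W·β + j) = 2` and then, `A = 2k + 1` being odd, `A - 2k = 1`).  Take `s = ∏ p` over the
prime factors `p` of the determinant `2jβ` NOT dividing `A`.  A common prime `p` of `A + 2sj` and
`β` either divides `A` — then `p ∤ s` (the factors of `s` are primes not dividing `A`), so
`p ∣ 2sj` gives `p ∣ 2j`, excluded — or does not — then `p ∣ β ∣ 2jβ` puts `p` among the factors
of `s`, so `p ∣ (A + 2sj) - 2sj = A`, a contradiction.  Mathlib only; no named facts; no `sorry`.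
-/

-- `Summit.HodgeConjecture.HodgeConjecture.Theorems` is the mandated namespace (single-conjunct summit:
-- Sub = Summit), which `linter.dupNamespace` flags on every declaration; the lakefile turns the
-- linter off tree-wide (weak option), restated here so stand-alone elaboration is warning-free too.
set_option linter.dupNamespace false

namespace Summit.HodgeConjecture.HodgeConjecture.Theorems

/-- **Coprime shift** (stub `stub_coprimeShift` of the line `Sketch`, pure arithmetic).  If `A` is
odd, `U * A + 2 * W * β + j = 1`, `β ≠ 0` and `j ≠ 0`, then `A + s * (2 * j)` is coprime to `β`
for some integer `s`, namely `s = ∏ p` over the prime factors `p` of `2jβ` (the determinant of the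
primitive matrix `(A β; 2j 0)`, up to sign) not dividing `A`: no prime divides `A`, `β` and `2j`
(it would divide `2 * (U * A + 2 * W * β + j) = 2` and, `A` being odd, `1`), and a common prime
of `A + 2sj` and `β` dividing `A` (resp. not dividing `A`) does not (resp. does) divide `s`,
whence it divides `2j` (resp. `A`) — impossible either way. [folklore] -/
theorem localTubeSpan_coprimeShift (A β j U W : ℤ) (hA : Odd A) (hrel : U * A + 2 * W * β + j = 1)
    (hβ : β ≠ 0) (hj : j ≠ 0) :
    ∃ s : ℤ, IsCoprime (A + s * (2 * j)) β := by
  classical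
  -- adapted from the tree's Literature lemma (file `HeckeOperatorsDoubleCoset.lean`)
  -- `Literature.NumberTheory.EllipticCurves.ModularForms.HeckeTComm.exists_isCoprime_add_mul`,
  -- case `(a b; c d) = (A β; 2j 0)`.
  -- Step 1 (primitivity): no prime divides `A`, `β` and `2 * j`.
  have hprim : ∀ p : ℕ, p.Prime → (p : ℤ) ∣ A → (p : ℤ) ∣ β → ¬ (p : ℤ) ∣ 2 * j := by
    intro p hp hpA hpβ hp2j
    have hpZ : Prime (p : ℤ) := Nat.prime_iff_prime_int.mp hp
    have h2 : (p : ℤ) ∣ 2 := by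
      have h : (2 : ℤ) = 2 * U * A + 2 * (2 * W) * β + 2 * j := by
        linear_combination (-2 : ℤ) * hrel
      rw [h]
      exact dvd_add (dvd_add (hpA.mul_left _) (hpβ.mul_left _)) hp2j
    obtain ⟨k, hk⟩ := hA
    have h1 : (1 : ℤ) = A - 2 * k := by rw [hk]; ring
    exact hpZ.not_dvd_one (h1 ▸ dvd_sub hpA (h2.mul_right k))
  -- Step 2: the shift `s = ∏ p` over the prime factors `p` of the determinant `2jβ ≠ 0` not
  -- dividing `A`.
  have hdet : 2 * j * β ≠ 0 := mul_ne_zero (mul_ne_zero two_ne_zero hj) hβ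
  set T : Finset ℕ := (2 * j * β).natAbs.primeFactors.filter (fun p : ℕ ↦ ¬ (p : ℤ) ∣ A)
  set s : ℤ := ∏ p ∈ T, (p : ℤ) with hs
  refine ⟨s, Int.isCoprime_iff_nat_coprime.mpr (Nat.coprime_of_dvd fun p hp hpa hpb ↦ ?_)⟩
  rw [← Int.natCast_dvd] at hpa hpb
  have hpZ : Prime (p : ℤ) := Nat.prime_iff_prime_int.mp hp
  by_cases hpA : (p : ℤ) ∣ A
  · -- `p ∉ T`, hence `p ∤ s`, hence `p ∣ 2 * j`: excluded by Step 1
    have hps : ¬ (p : ℤ) ∣ s := by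
      intro h
      rw [hs, hpZ.dvd_finsetProd_iff] at h
      obtain ⟨q, hqT, hpq⟩ := h
      rw [Int.natCast_dvd_natCast] at hpq
      obtain ⟨hq, hqA⟩ := Finset.mem_filter.mp hqT
      obtain rfl : p = q :=
        (Nat.prime_dvd_prime_iff_eq hp (Nat.prime_of_mem_primeFactors hq)).mp hpq
      exact hqA hpA
    have h2j : (p : ℤ) ∣ s * (2 * j) := by
      have := dvd_sub hpa hpA
      rwa [add_sub_cancel_left] at this
    exact hprim p hp hpA hpb ((hpZ.dvd_or_dvd h2j).resolve_left hps)
  · -- `p ∣ β ∣ 2jβ` and `p ∤ A`: `p ∈ T`, hence `p ∣ s`, hence `p ∣ A` after all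
    have hpT : p ∈ T :=
      Finset.mem_filter.mpr ⟨Nat.mem_primeFactors.mpr
        ⟨hp, Int.natCast_dvd.mp (hpb.mul_left (2 * j)), Int.natAbs_ne_zero.mpr hdet⟩, hpA⟩
    have hps : (p : ℤ) ∣ s := Finset.dvd_prod_of_mem _ hpT
    refine hpA ?_
    have := dvd_sub hpa (dvd_mul_of_dvd_left hps (2 * j))
    rwa [add_sub_cancel_right] at this

end Summit.HodgeConjecture.HodgeConjecture.Theorems
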